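import Literature.Computability.AlgebraicComplexity.StandardFamilies
import Literature.Computability.AlgebraicComplexity.Hyperdeterminant
import HarnessLib

/-!
# Ikenmeyer's Kronecker product of forms and the hypercomputant matrix

Topic `Literature/Computability/AlgebraicComplexity`. DEFINITIONS (D-0014: real definitions, no
named facts, no conjectures) from C. Ikenmeyer, *Kronecker products and iterated matrix
multiplication*, arXiv:2606.08363 (2026) — a PREPRINT: its theorems are deliberately NOT vendored
here; only its definitions are rendered in the tree's vocabulary, together with identities that
are proved in the kernel below. Tree vocabulary used: `StandardFamilies.immMatrix ι d k =
X^{(0)} ⋯ X^{(d-1)}` (the computant matrix), `StandardFamilies.perPoly` (the generic permanent),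
`Hyperdeterminant.wordExp` (the content of a word `Fin d → σ`).

SETTING [Ikenmeyer 2026, §2–§4, commutative case `A = S`; printed numbering of the arXiv v1 PDF (41 pp.):
subsections are Roman (`§4.2` below = printed `§4.II`), theorem-like environments and equations share
one section-wise counter]: `R` a commutative semiring, `S_d` the
forms of degree `d` in a set of variables; `X_n^{(k)} = (x^{(k)}_{i,j})` the generic `n × n`
matrix in its own `n²` variables, `k = 1, …, d`.

WHAT IS REPRODUCED (verbatim):

* §3, Definition 3.1 (The computant matrix), p. 6 [tree: `immMatrix`; here `computantEntry`]: "The computant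
  matrix `Ξ_{n,d} ∈ Mat_n(A_d)` is defined as `X_n^{(1)} ⋯ X_n^{(d)}`. We denote the bottom-right
  entry with `Γ_{n,d} := [Ξ_{n,d}]_{n,n}`. For `A = S`, `Γ_{n,d}` is called the iterated matrix
  multiplication polynomial."
* §4.2 (= printed §4.II), eq. (defboxtimes) = (4.4), p. 11 [`kronWord`, `kronMonomial`, `kronProd`]: "For `f, h ∈ A_d` we define
  `f ⊠ h ∈ A_d` via `(x_{i_1} ⋯ x_{i_d}) ⊠ (x_{j_1} ⋯ x_{j_d}) := Σ_{π ∈ 𝔖_d}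
  x_{i_1,j_{π(1)}} ⋯ x_{i_d,j_{π(d)}}` and bilinear extension." (well-defined and associative,
  loc. cit.; eq. (4.7): "both `f ⊠ h ≤ h ⊠ f` and `h ⊠ f ≤ f ⊠ h`" "by renaming each `x_{i,j}` to
  `x_{j,i}`" [`kronProd_comm`]).
* §4.3 (= §4.III), eq. (kronactionmatrix) = (4.20), p. 15 (the Kronecker product of matrices of
  forms, indices `an + a'`, `bn + b'`) and §4.4 (= §4.IV), p. 15: "We define the hypercomputant
  matrix as `Ξ̂_{n,d} := 𝖧_{n,d} ⊠ Ξ_{n,d}` and its bottom-right entry `Γ̂_{n,d} ∈ A_d` as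
  `Γ̂_{n,d} := H_{n,d} ⊠ Γ_{n,d}`", where the MATRIX `𝖧_{n,d} := pol(Ξ_{n,d}) ∈ Mat_n(Symt_d)`
  (eq. (4.22)) and its bottom-right ENTRY `H_{n,d} := pol(Γ_{n,d}) ∈ Symt_d` (eq. (4.23)) are
  distinguished by font in the source; Remark 4.26, p. 16: "Note that if `A = S`, then
  `Γ̂_{n,d} = Γ_{n,d}^{⊠2}`."
  [`hypercomputantMatrix`, `hypercomputantEntry`]
* §4.4, Example 4.29 item 1, p. 16: "The permanent: `mon_d ⊠ mon_d = Γ̂_{1,d}`" (`mon_d = x_1 ⋯ x_d`;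
  Example 4.10 item 1, p. 12: "The permanent polynomial: `per_d := mon_d ⊠ mon_d`")
  [`kronProd_prod_X_self_eq_perPoly`, `hypercomputantEntry_fin_one`].

RENDERING / design choices. (1) A monomial of degree `d` is the content `wordExp I` of a word
`I : Fin d → σ` (`exists_wordExp_eq`); `kronWord I J` is the displayed sum for two WORDS, it is
invariant under reshuffling either word (`kronWord_comp_perm_left/right` — this is the
well-definedness remark of §4.2), and `kronMonomial a b` evaluates it on words chosen by
`Classical.choose`, independently of the choice (`kronMonomial_wordExp`). (2) JUNK VALUE: the
source defines `f ⊠ h` only for two forms of the SAME degree `d`; here `kronMonomial a b := 0`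
when `deg a ≠ deg b`, so `kronProd f h` pairs the degree-`e` parts of `f` and `h` for every `e`
and kills mixed degrees — for `f, h` forms of one common degree this is literally eq.
(defboxtimes). (3) The variables of `f ⊠ h` are PAIRS `σ × τ` ("`x_{i,j}`"); for the
hypercomputant the variable type is `(Fin d × ι × ι) × (Fin d × ι × ι)`, the source's
`x^{(k)}_{i,j} ⊠ x^{(k')}_{i',j'}`, `n⁴d²` of them (§4.4). (4) The tree's computant
`immMatrix ι d k` has 0-indexed layers and an arbitrary finite index type `ι`; the source's
"bottom-right entry" is rendered as the diagonal entry `computantEntry ι d k a = Ξ_{a,a}` for a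
chosen `a : ι` (all diagonal entries agree up to renaming variables; §4.4, Remark 4.24 on
`w(Γ̂) ≤ w(Ξ̂) ≤ n⁴ w(Γ̂)` (eq. (4.25)): "all entries of the matrix `Ξ̂_{n,d}` are the same up to renaming
variables"). NOTE: the tree's `immPoly n d k` is the TRACE `tr Ξ_{n,d}`, which §8.1 (= §8.I) of the source
distinguishes sharply from `Γ_{n,d}`; it is not used here. (5) Only the commutative case `A = S`
is rendered. There `𝖧_{n,d} ⊠ Ξ_{n,d}` is, entry by entry, `Ξ_{n,d} ⊠ Ξ_{n,d}` (Remark 4.26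
quoted above, whose proof is entry-independent), and THIS is the definition of
`hypercomputantMatrix`: the Kronecker product of the matrix `Ξ` with itself in which the product
of entries is `⊠`, `[Ξ̂]_{(a,a'),(b,b')} = Ξ_{a,b} ⊠ Ξ_{a',b'}`.

WHAT IS PROVED HERE (kernel, no facts assumed): reshuffling invariance and choice-independence;
`kronProd` is biadditive, vanishes on `0`, equals `kronWord` on monomials of words, and is
commutative up to the swap renaming; `mon_d ⊠ mon_d = per_d` on the nose
(`kronProd (∏ i, X i) (∏ i, X i) = perPoly (Fin d) R`, Example 4.29 of §4.4); and the `n = 1`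
hypercomputant `Γ̂_{1,d}` is `per_d` after the renaming `x_{i,j} ↦ x^{(i)}_{1,1} ⊠ x^{(j)}_{1,1}`
(`hypercomputantEntry_fin_one`).

NOT here (deliberately): the tensor / noncommutative variants `A ∈ {T, W}` and `pol`; width `w`,
restrictions `≤` and homogeneous ABPs (§2.4, §3); Claims 4.27–4.28 of §4.4; the VNP-completeness
theorem (Theorem 6.1, §6, p. 26); Valiant's conjecture in the form "`w(Ξ̂_{n,d}) ∉ poly(n,d)`"
(Conjecture 4.30, §4.5, p. 17 — an open problem); and all of §8 (stabilizers, polystability, multiplicity formulas) — statements of a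
preprint that the accompanying census only quotes.

## References

* C. Ikenmeyer, *Kronecker products and iterated matrix multiplication*, arXiv:2606.08363
  (2026), v1 of June 6, 2026, 41 pp.: Definition 3.1 (`Ξ_{n,d}`, `Γ_{n,d}`), §4.2 eq. (4.4)
  (defboxtimes), §4.3 eq. (4.20), §4.4 eqs. (4.22)–(4.23) (Definition of `Ξ̂_{n,d}`), Remarks
  4.24 and 4.26, Examples 4.10 and 4.29 (printed numbers of the PDF; the section numbers §4.2 etc.
  are the ordinal positions, printed §4.II etc.). [Ikenmeyer2026Kronecker]
* L. G. Valiant, *Completeness classes in algebra*, STOC 1979 (the permanent `per_d`).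
  [Valiant1979]
-/

noncomputable section

open MvPolynomial

namespace Literature.Computability.AlgebraicComplexity

universe u v w

section KroneckerProduct

variable {σ : Type v} {τ : Type w} {R : Type u} [CommSemiring R] {d : ℕ}

/-- The Kronecker product of two WORDS `I : Fin d → σ`, `J : Fin d → τ` of the same length
(Ikenmeyer 2026, §4.2, eq. (defboxtimes), for the monomials `x_{I 0} ⋯ x_{I (d-1)}` and
`x_{J 0} ⋯ x_{J (d-1)}`): `Σ_{π ∈ 𝔖_d} ∏_t x_{(I t, J (π t))}`, a form of degree `d` in the pair
variables `σ × τ`. [cite: Ikenmeyer2026Kronecker, §4.2] -/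
def kronWord (I : Fin d → σ) (J : Fin d → τ) : MvPolynomial (σ × τ) R :=
  ∑ π : Equiv.Perm (Fin d), ∏ t, X (I t, J (π t))

/-- Reshuffling the second word does not change the Kronecker product (reindex `π ↦ ρπ`;
Ikenmeyer 2026, §4.2: "`⊠` is well-defined"). [cite: Ikenmeyer2026Kronecker, §4.2] -/
theorem kronWord_comp_perm_right (I : Fin d → σ) (J : Fin d → τ) (ρ : Equiv.Perm (Fin d)) :
    kronWord (R := R) I (J ∘ ρ) = kronWord I J := by
  unfold kronWord
  exact Fintype.sum_equiv (Equiv.mulLeft ρ) _ _ fun π => by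
    simp only [Equiv.coe_mulLeft, Function.comp_apply, Equiv.Perm.mul_apply]

/-- Reshuffling the first word does not change the Kronecker product (reindex the product by
`ρ` and the sum by `π ↦ πρ⁻¹`; Ikenmeyer 2026, §4.2: "`⊠` is well-defined").
[cite: Ikenmeyer2026Kronecker, §4.2] -/
theorem kronWord_comp_perm_left (I : Fin d → σ) (J : Fin d → τ) (ρ : Equiv.Perm (Fin d)) :
    kronWord (R := R) (I ∘ ρ) J = kronWord I J := by
  unfold kronWord
  refine Fintype.sum_equiv (Equiv.mulRight ρ⁻¹) _ _ fun π => ?_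
  simp only [Equiv.coe_mulRight, Function.comp_apply]
  exact Fintype.prod_equiv ρ _ _ fun t => by
    simp only [Equiv.Perm.mul_apply, Equiv.Perm.coe_inv, Equiv.symm_apply_apply]

/-- Words with equal contents have equal Kronecker products: the value of eq. (defboxtimes)
depends only on the two MONOMIALS (Ikenmeyer 2026, §4.2). [cite: Ikenmeyer2026Kronecker, §4.2] -/
theorem kronWord_eq_of_wordExp_eq {m : ℕ} {I' : Fin m → σ} {J' : Fin m → τ} {I : Fin d → σ}
    {J : Fin d → τ} (hI : wordExp I' = wordExp I) (hJ : wordExp J' = wordExp J) :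
    kronWord (R := R) I' J' = kronWord I J := by
  classical
  obtain rfl : m = d := by
    have h := congrArg Finsupp.degree hI
    rwa [degree_wordExp, degree_wordExp] at h
  obtain ⟨π, rfl⟩ := exists_comp_perm_eq_of_wordExp_eq hI
  obtain ⟨ρ, rfl⟩ := exists_comp_perm_eq_of_wordExp_eq hJ
  rw [kronWord_comp_perm_left, kronWord_comp_perm_right]

/-- Swapping the two words is the renaming `x_{i,j} ↦ x_{j,i}` (Ikenmeyer 2026, §4.2:
"`f ⊠ h ≤ h ⊠ f`"). [cite: Ikenmeyer2026Kronecker, §4.2] -/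
theorem kronWord_swap (I : Fin d → σ) (J : Fin d → τ) :
    kronWord (R := R) J I = rename Prod.swap (kronWord I J) := by
  unfold kronWord
  rw [map_sum]
  refine Fintype.sum_equiv (Equiv.inv (Equiv.Perm (Fin d))) _ _ fun π => ?_
  rw [map_prod, Equiv.inv_apply]
  exact Fintype.prod_equiv π _ _ fun t => by
    simp only [rename_X, Prod.swap_prod_mk, Equiv.Perm.coe_inv, Equiv.symm_apply_apply]

/-- The monomial of a word is the product of its letters (semiring version of
`prod_X_eq_monomial_wordExp`). [folklore] -/
theorem prod_X_word_eq_monomial (I : Fin d → σ) :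
    (∏ t, X (I t) : MvPolynomial σ R) = monomial (wordExp I) 1 := by
  rw [wordExp, monomial_sum_index, C_1, one_mul]
  rfl

/-- The Kronecker product of two MONOMIALS given by exponent vectors `a`, `b` (Ikenmeyer 2026,
§4.2, eq. (defboxtimes)): `kronWord I J` for any words `I`, `J` of contents `a`, `b` (chosen by
`Classical.choose`; the value does not depend on the choice, `kronMonomial_wordExp`). JUNK
VALUE `0` when `deg a ≠ deg b` (the source only pairs forms of equal degree).
[cite: Ikenmeyer2026Kronecker, §4.2] -/
def kronMonomial (a : σ →₀ ℕ) (b : τ →₀ ℕ) : MvPolynomial (σ × τ) R :=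
  haveI := Classical.decEq σ
  haveI := Classical.decEq τ
  if h : b.degree = a.degree then
    kronWord (exists_wordExp_eq a rfl).choose (exists_wordExp_eq b h).choose
  else 0

/-- On contents of words, `kronMonomial` is the displayed sum `kronWord` (choice-independence;
Ikenmeyer 2026, §4.2). [cite: Ikenmeyer2026Kronecker, §4.2] -/
theorem kronMonomial_wordExp (I : Fin d → σ) (J : Fin d → τ) :
    kronMonomial (R := R) (wordExp I) (wordExp J) = kronWord I J := by
  classical
  have h : (wordExp J).degree = (wordExp I).degree := by rw [degree_wordExp, degree_wordExp]
  unfold kronMonomial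
  rw [dif_pos h]
  exact kronWord_eq_of_wordExp_eq (exists_wordExp_eq (wordExp I) rfl).choose_spec
    (exists_wordExp_eq (wordExp J) h).choose_spec

/-- Mixed degrees are killed (the documented junk value). [cite: Ikenmeyer2026Kronecker, §4.2] -/
theorem kronMonomial_of_degree_ne {a : σ →₀ ℕ} {b : τ →₀ ℕ} (h : b.degree ≠ a.degree) :
    kronMonomial (R := R) a b = 0 := by
  unfold kronMonomial
  rw [dif_neg h]

/-- Swapping the two monomials is the renaming `x_{i,j} ↦ x_{j,i}` (Ikenmeyer 2026, §4.2:
"`f ⊠ h ≤ h ⊠ f`"). [cite: Ikenmeyer2026Kronecker, §4.2] -/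
theorem kronMonomial_swap (a : σ →₀ ℕ) (b : τ →₀ ℕ) :
    kronMonomial (R := R) b a = rename Prod.swap (kronMonomial a b) := by
  classical
  by_cases h : b.degree = a.degree
  · obtain ⟨I, hI⟩ := exists_wordExp_eq a rfl
    obtain ⟨J, hJ⟩ := exists_wordExp_eq b h
    rw [← hI, ← hJ, kronMonomial_wordExp, kronMonomial_wordExp, kronWord_swap]
  · rw [kronMonomial_of_degree_ne h, kronMonomial_of_degree_ne (Ne.symm h), map_zero]

/-- **The Kronecker product `f ⊠ h` of two polynomials** (Ikenmeyer 2026, §4.2, eq.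
(defboxtimes) "and bilinear extension"): `Σ_{a,b} f_a h_b · (x^a ⊠ x^b)` in the pair variables
`σ × τ`. For `f`, `h` forms of a common degree `d` this is literally the source's `f ⊠ h ∈ S_d`;
in general it is the sum over `e` of (degree-`e` part of `f`) ⊠ (degree-`e` part of `h`)
(junk-value convention of `kronMonomial`). [cite: Ikenmeyer2026Kronecker, §4.2] -/
def kronProd (f : MvPolynomial σ R) (h : MvPolynomial τ R) : MvPolynomial (σ × τ) R :=
  (AddMonoidAlgebra.coeff f).sum fun a r =>
    (AddMonoidAlgebra.coeff h).sum fun b s => C (r * s) * kronMonomial a b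

/-- `⊠` on monomials. [cite: Ikenmeyer2026Kronecker, §4.2] -/
theorem kronProd_monomial_monomial (a : σ →₀ ℕ) (b : τ →₀ ℕ) (r s : R) :
    kronProd (monomial a r) (monomial b s) = C (r * s) * kronMonomial a b := by
  unfold kronProd
  rw [sum_monomial_eq, sum_monomial_eq] <;>
    simp only [mul_zero, zero_mul, C_0, Finsupp.sum_fun_zero]

/-- `0 ⊠ h = 0`. [cite: Ikenmeyer2026Kronecker, §4.2] -/
theorem kronProd_zero_left (h : MvPolynomial τ R) : kronProd (0 : MvPolynomial σ R) h = 0 := by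
  simp [kronProd]

/-- `f ⊠ 0 = 0`. [cite: Ikenmeyer2026Kronecker, §4.2] -/
theorem kronProd_zero_right (f : MvPolynomial σ R) : kronProd f (0 : MvPolynomial τ R) = 0 := by
  simp [kronProd]

/-- `⊠` is additive in the first argument ("bilinear extension"). [cite: Ikenmeyer2026Kronecker, §4.2] -/
theorem kronProd_add_left (f g : MvPolynomial σ R) (h : MvPolynomial τ R) :
    kronProd (f + g) h = kronProd f h + kronProd g h := by
  unfold kronProd
  rw [AddMonoidAlgebra.coeff_add, Finsupp.sum_add_index']
  · intro a
    simp only [zero_mul, C_0, Finsupp.sum_fun_zero]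
  · intro a r₁ r₂
    simp only [add_mul, map_add, Finsupp.sum_add]

/-- `⊠` is additive in the second argument ("bilinear extension"). [cite: Ikenmeyer2026Kronecker, §4.2] -/
theorem kronProd_add_right (f : MvPolynomial σ R) (h₁ h₂ : MvPolynomial τ R) :
    kronProd f (h₁ + h₂) = kronProd f h₁ + kronProd f h₂ := by
  unfold kronProd
  rw [← Finsupp.sum_add]
  refine Finsupp.sum_congr fun a _ => ?_
  rw [AddMonoidAlgebra.coeff_add, Finsupp.sum_add_index']
  · intro b
    simp only [mul_zero, C_0, zero_mul]
  · intro b s₁ s₂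
    simp only [mul_add, map_add, add_mul]

/-- `(r f) ⊠ h = r (f ⊠ h)` for a scalar `r` ("bilinear"). [cite: Ikenmeyer2026Kronecker, §4.2] -/
theorem kronProd_C_mul_left (r : R) (f : MvPolynomial σ R) (h : MvPolynomial τ R) :
    kronProd (C r * f) h = C r * kronProd f h := by
  unfold kronProd
  rw [C_mul', AddMonoidAlgebra.coeff_smul, Finsupp.sum_smul_index', Finsupp.mul_sum]
  · refine Finsupp.sum_congr fun a _ => ?_
    rw [Finsupp.mul_sum]
    refine Finsupp.sum_congr fun b _ => ?_
    rw [smul_eq_mul, mul_assoc, map_mul, mul_assoc]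
  · intro a
    simp only [zero_mul, C_0, Finsupp.sum_fun_zero]

/-- On monomials of WORDS, `⊠` is the displayed sum of eq. (defboxtimes):
`(∏_t x_{I t}) ⊠ (∏_t x_{J t}) = Σ_π ∏_t x_{(I t, J (π t))}`. [cite: Ikenmeyer2026Kronecker, §4.2] -/
theorem kronProd_prod_X (I : Fin d → σ) (J : Fin d → τ) :
    kronProd (∏ t, X (I t) : MvPolynomial σ R) (∏ t, X (J t)) = kronWord I J := by
  rw [prod_X_word_eq_monomial, prod_X_word_eq_monomial, kronProd_monomial_monomial, mul_one, C_1,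
    one_mul, kronMonomial_wordExp]

/-- `h ⊠ f` is `f ⊠ h` with the variables renamed by `x_{i,j} ↦ x_{j,i}` (Ikenmeyer 2026, §4.2:
"`f ⊠ h ≤ h ⊠ f`"). [cite: Ikenmeyer2026Kronecker, §4.2] -/
theorem kronProd_comm (f : MvPolynomial σ R) (h : MvPolynomial τ R) :
    kronProd h f = rename Prod.swap (kronProd f h) := by
  unfold kronProd
  rw [map_finsuppSum, Finsupp.sum_comm]
  refine Finsupp.sum_congr fun a _ => ?_
  rw [map_finsuppSum]
  refine Finsupp.sum_congr fun b _ => ?_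
  rw [map_mul (rename Prod.swap), rename_C, kronMonomial_swap a b,
    mul_comm (AddMonoidAlgebra.coeff f a)]

/-- **KERNEL — Ikenmeyer's Example 4.29 "The permanent: `mon_d ⊠ mon_d = Γ̂_{1,d}`"**, first half:
`(x_0 ⋯ x_{d-1}) ⊠ (x_0 ⋯ x_{d-1}) = Σ_π ∏_t x_{(t, π t)} = per_d`, literally the tree's generic
permanent `perPoly (Fin d) R = per (x_{i,j})` (via `Matrix.permanent_transpose`).
[cite: Ikenmeyer2026Kronecker, §4.4] -/
theorem kronWord_id_eq_perPoly :
    kronWord (R := R) (id : Fin d → Fin d) id = perPoly (Fin d) R := by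
  rw [perPoly, ← Matrix.permanent_transpose]
  simp [kronWord, Matrix.permanent, Matrix.transpose_apply, Matrix.mvPolynomialX_apply]

/-- **KERNEL — `mon_d ⊠ mon_d = per_d`** (Ikenmeyer 2026, §4.4, Example 4.29 "The permanent"), with
`mon_d = x_0 ⋯ x_{d-1}` and `per_d = perPoly (Fin d) R`. [cite: Ikenmeyer2026Kronecker, §4.4] -/
theorem kronProd_prod_X_self_eq_perPoly :
    kronProd (∏ i : Fin d, (X i : MvPolynomial (Fin d) R)) (∏ i : Fin d, X i) = perPoly (Fin d) R := by
  rw [← kronWord_id_eq_perPoly, ← kronProd_prod_X]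
  rfl

end KroneckerProduct

section Hypercomputant

variable (ι : Type v) [Fintype ι] [DecidableEq ι] (d : ℕ) (k : Type u) [CommSemiring k]

/-- An entry `Γ = [Ξ_{n,d}]_{a,a}` of the computant matrix `Ξ = X^{(0)} ⋯ X^{(d-1)}`
(`immMatrix`): Ikenmeyer's ITERATED MATRIX MULTIPLICATION POLYNOMIAL `Γ_{n,d}` ("the bottom-right
entry"; all diagonal entries agree up to renaming variables). Not the trace `immPoly`.
[cite: Ikenmeyer2026Kronecker, §3] -/
def computantEntry (a : ι) : MvPolynomial (Fin d × ι × ι) k :=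
  immMatrix ι d k a a

/-- **The hypercomputant matrix `Ξ̂_{n,d}`** (Ikenmeyer 2026, §4.4, commutative case `A = S`):
the Kronecker product `Ξ ⊠ Ξ` of the computant matrix `Ξ = immMatrix ι d k` with itself, with
`⊠ = kronProd` as the product of entries — `[Ξ̂]_{(a,a'),(b,b')} = Ξ_{a,b} ⊠ Ξ_{a',b'}`
(§4.3 eq. (4.20) (kronactionmatrix) with indices `an + a'`, `bn + b'`; by Remark 4.26 of §4.4,
`𝖧_{n,d} ⊠ Ξ_{n,d}` has exactly these entries when `A = S`). An `n² × n²` matrix of forms of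
degree `d` in the `n⁴d²` variables `x^{(t)}_{i,j} ⊠ x^{(t')}_{i',j'}`.
[cite: Ikenmeyer2026Kronecker, §4.4] -/
def hypercomputantMatrix :
    Matrix (ι × ι) (ι × ι) (MvPolynomial ((Fin d × ι × ι) × (Fin d × ι × ι)) k) :=
  Matrix.of fun a b => kronProd (immMatrix ι d k a.1 b.1) (immMatrix ι d k a.2 b.2)

/-- **The hypercomputant `Γ̂_{n,d} = Γ_{n,d} ⊠ Γ_{n,d}`** (Ikenmeyer 2026, §4.4 and Remark 4.26: "if
`A = S`, then `Γ̂_{n,d} = Γ_{n,d}^{⊠2}`"): the diagonal entry `[Ξ̂]_{(a,a),(a,a)}`.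
[cite: Ikenmeyer2026Kronecker, §4.4] -/
def hypercomputantEntry (a : ι) : MvPolynomial ((Fin d × ι × ι) × (Fin d × ι × ι)) k :=
  hypercomputantMatrix ι d k (a, a) (a, a)

/-- Unfolding: `[Ξ̂]_{(a,a'),(b,b')} = Ξ_{a,b} ⊠ Ξ_{a',b'}`. [cite: Ikenmeyer2026Kronecker, §4.4] -/
theorem hypercomputantMatrix_apply (a b : ι × ι) :
    hypercomputantMatrix ι d k a b = kronProd (immMatrix ι d k a.1 b.1) (immMatrix ι d k a.2 b.2) :=
  rfl

/-- Unfolding: `Γ̂ = Γ ⊠ Γ` (Remark 4.26 of §4.4). [cite: Ikenmeyer2026Kronecker, §4.4] -/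
theorem hypercomputantEntry_eq (a : ι) :
    hypercomputantEntry ι d k a = kronProd (computantEntry ι d k a) (computantEntry ι d k a) :=
  rfl

variable {k}

/-- The `(0,0)` entry of a product of `1 × 1` matrices is the product of the entries.
[folklore] -/
theorem listProd_fin_one_apply {A : Type u} [Semiring A] (L : List (Matrix (Fin 1) (Fin 1) A)) :
    L.prod 0 0 = (L.map fun M => M 0 0).prod := by
  induction L with
  | nil => simp
  | cons M L ih => simp [Matrix.mul_apply, ih]

variable (k)

/-- For `n = 1` the computant is the monomial `x^{(0)}_{1,1} ⋯ x^{(d-1)}_{1,1}` in `d` distinct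
variables (`= mon_d` up to renaming). [cite: Ikenmeyer2026Kronecker, §3] -/
theorem immMatrix_fin_one_apply :
    immMatrix (Fin 1) d k 0 0 = ∏ t : Fin d, X (t, (0 : Fin 1), (0 : Fin 1)) := by
  rw [immMatrix, listProd_fin_one_apply, List.map_map, Fin.prod_univ_def]
  simp [Function.comp_def, Matrix.map_apply, Matrix.mvPolynomialX_apply, rename_X]

/-- **KERNEL — Ikenmeyer's Example 4.29 "The permanent: `mon_d ⊠ mon_d = Γ̂_{1,d}`"**: the `n = 1`
hypercomputant is the generic permanent `per_d = perPoly (Fin d) k` after the renaming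
`x_{i,j} ↦ x^{(i)}_{1,1} ⊠ x^{(j)}_{1,1}` — the smallest hypercomputant is `VNP`'s standard
complete polynomial. [cite: Ikenmeyer2026Kronecker, §4.4] -/
theorem hypercomputantEntry_fin_one :
    hypercomputantEntry (Fin 1) d k 0 =
      rename (fun ij : Fin d × Fin d =>
        (((ij.1, 0, 0) : Fin d × Fin 1 × Fin 1), ((ij.2, 0, 0) : Fin d × Fin 1 × Fin 1)))
        (perPoly (Fin d) k) := by
  rw [hypercomputantEntry, hypercomputantMatrix_apply, immMatrix_fin_one_apply, kronProd_prod_X,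
    ← kronWord_id_eq_perPoly, kronWord, kronWord, map_sum]
  simp [map_prod, rename_X]

end Hypercomputant

/-! ## `det_d ⊠ det_d` is Cayley's first hyperdeterminant

[Ike26, abstract, first sentence (PDF p. 1)]: "We observe that the Kronecker product of tensors is the
operation that converts the determinant polynomial into Cayley's first hyperdeterminant."; §4.2
Example 4.10 item 5 (p. 12):
"Cayley's first hyperdeterminant: `det_d^{⊠m}`". For `m = 2` we prove the precise form: the
tree's combinatorial hyperdeterminant `hyperdet` (four Levi-Civita contractions,
`Hyperdeterminant.lean`) of the generic `d × d × d × d` array `(i₀,i₁,i₂,i₃) ↦ x_{(i₀,i₁),(i₂,i₃)}`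
equals `d! · (det_d ⊠ det_d)`; the factor `d!` is the over-count built into `hyperdet` ("each
geometric term counted `kk!` times"). -/

section KroneckerSums

variable {σ : Type v} {τ : Type w} {R : Type u} {d : ℕ}

/-- `⊠` is additive in the first argument: Finset sums. [cite: Ikenmeyer2026Kronecker, §4.2] -/
theorem kronProd_sum_left [CommSemiring R] {ι' : Type*} (s : Finset ι')
    (f : ι' → MvPolynomial σ R) (h : MvPolynomial τ R) :
    kronProd (∑ i ∈ s, f i) h = ∑ i ∈ s, kronProd (f i) h := by
  classical
  induction s using Finset.induction_on with
  | empty => simp [kronProd_zero_left]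
  | insert a s ha ih => rw [Finset.sum_insert ha, Finset.sum_insert ha, kronProd_add_left, ih]

/-- `⊠` is additive in the second argument: Finset sums. [cite: Ikenmeyer2026Kronecker, §4.2] -/
theorem kronProd_sum_right [CommSemiring R] {ι' : Type*} (s : Finset ι')
    (f : MvPolynomial σ R) (h : ι' → MvPolynomial τ R) :
    kronProd f (∑ i ∈ s, h i) = ∑ i ∈ s, kronProd f (h i) := by
  classical
  induction s using Finset.induction_on with
  | empty => simp [kronProd_zero_right]
  | insert a s ha ih => rw [Finset.sum_insert ha, Finset.sum_insert ha, kronProd_add_right, ih]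

/-- `f ⊠ (r · h) = r · (f ⊠ h)`. [cite: Ikenmeyer2026Kronecker, §4.2] -/
theorem kronProd_C_mul_right [CommSemiring R] (r : R) (f : MvPolynomial σ R)
    (h : MvPolynomial τ R) : kronProd f (C r * h) = C r * kronProd f h := by
  unfold kronProd
  rw [C_mul', AddMonoidAlgebra.coeff_smul, Finsupp.mul_sum]
  refine Finsupp.sum_congr fun a _ => ?_
  rw [Finsupp.sum_smul_index', Finsupp.mul_sum]
  · refine Finsupp.sum_congr fun b _ => ?_
    rw [smul_eq_mul, map_mul, map_mul, map_mul]
    ring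
  · intro b
    simp only [mul_zero, C_0, zero_mul]

/-- Integer scalars pull out of `⊠` (first argument). [cite: Ikenmeyer2026Kronecker, §4.2] -/
theorem kronProd_intCast_mul_left [CommRing R] (n : ℤ) (f : MvPolynomial σ R)
    (h : MvPolynomial τ R) :
    kronProd ((n : MvPolynomial σ R) * f) h = (n : MvPolynomial (σ × τ) R) * kronProd f h := by
  rw [← map_intCast (C : R →+* MvPolynomial σ R) n, kronProd_C_mul_left, map_intCast]

/-- Integer scalars pull out of `⊠` (second argument). [cite: Ikenmeyer2026Kronecker, §4.2] -/
theorem kronProd_intCast_mul_right [CommRing R] (n : ℤ) (f : MvPolynomial σ R)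
    (h : MvPolynomial τ R) :
    kronProd f ((n : MvPolynomial τ R) * h) = (n : MvPolynomial (σ × τ) R) * kronProd f h := by
  rw [← map_intCast (C : R →+* MvPolynomial τ R) n, kronProd_C_mul_right, map_intCast]

end KroneckerSums

section DetKron

variable (d : ℕ) (R : Type u) [CommRing R]

/-- The generic four-dimensional array of format `d × d × d × d` over the variables of
`det_d ⊠ det_d`: entry `(i₀, i₁, i₂, i₃) ↦ x_{(i₀,i₁),(i₂,i₃)}`.
[cite: Ikenmeyer2026Kronecker, §4.2] -/
def kronPairArray : (Fin 4 → Fin d) → MvPolynomial ((Fin d × Fin d) × (Fin d × Fin d)) R :=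
  fun I => X ((I 0, I 1), (I 2, I 3))

/-- Change of summation variables `(τ₀, τ₁, τ₂, τ₃) ↔ (ρ, σ, σ', π)` with
`τ = (σρ, ρ, σ'πρ, πρ)`, used to compare the hyperdeterminant sum with `det ⊠ det`. [folklore] -/
def quadPermEquiv : (Fin 4 → Equiv.Perm (Fin d)) ≃
    Equiv.Perm (Fin d) × Equiv.Perm (Fin d) × Equiv.Perm (Fin d) × Equiv.Perm (Fin d) where
  toFun τ := (τ 1, τ 0 * (τ 1)⁻¹, τ 2 * (τ 3)⁻¹, τ 3 * (τ 1)⁻¹)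
  invFun p := ![p.2.1 * p.1, p.1, p.2.2.1 * p.2.2.2 * p.1, p.2.2.2 * p.1]
  left_inv τ := by
    funext j
    fin_cases j <;> simp [mul_assoc]
  right_inv p := by
    rcases p with ⟨ρ, σ, σ', π⟩
    simp [mul_assoc]

/-- The determinant form as a signed sum of word monomials:
`det_d = ∑_σ sgn(σ) ∏_i x_{σ(i), i}`. [folklore] -/
theorem detPoly_eq_sum_sign_mul_prod :
    detPoly (Fin d) R = ∑ σ : Equiv.Perm (Fin d),
      ((Equiv.Perm.sign σ : ℤ) : MvPolynomial (Fin d × Fin d) R) * ∏ i, X (σ i, i) := by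
  rw [detPoly, Matrix.det_apply']
  simp only [Matrix.mvPolynomialX_apply]

/-- **The Kronecker product converts the determinant into Cayley's first hyperdeterminant**
([Ike26] abstract, "the Kronecker product of tensors is the operation that converts the determinant
polynomial into Cayley's first hyperdeterminant"; §4.2 Example 4.10 item 5, "Cayley's first hyperdeterminant:
`det_d^{⊠m}`", case `m = 2`):
`Det(x_{(τ₀ i, τ₁ i),(τ₂ i, τ₃ i)}) = d! · (det_d ⊠ det_d)`, where `Det` is the tree's `hyperdet`
(format `d^{×4}`, which counts every geometric term `d!` times).
[cite: Ikenmeyer2026Kronecker, §4.2] -/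
theorem hyperdet_kronPairArray :
    hyperdet (kronPairArray d R) =
      (Nat.factorial d) • kronProd (detPoly (Fin d) R) (detPoly (Fin d) R) := by
  classical
  -- signs: `sgn(σρ) sgn(ρ) sgn(σ'πρ) sgn(πρ) = sgn(σ) sgn(σ')`
  have hu : ∀ ρ σ σ' π : Equiv.Perm (Fin d),
      Equiv.Perm.sign (σ * ρ) * Equiv.Perm.sign ρ * Equiv.Perm.sign (σ' * π * ρ) *
        Equiv.Perm.sign (π * ρ) = Equiv.Perm.sign σ * Equiv.Perm.sign σ' := by
    intro ρ σ σ' π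
    simp only [Equiv.Perm.sign_mul]
    rcases Int.units_eq_one_or (Equiv.Perm.sign ρ) with h | h <;>
      rcases Int.units_eq_one_or (Equiv.Perm.sign π) with h' | h' <;>
      simp [h, h']
  have hsign : ∀ ρ σ σ' π : Equiv.Perm (Fin d),
      ((Equiv.Perm.sign (σ * ρ) : ℤ) : MvPolynomial ((Fin d × Fin d) × (Fin d × Fin d)) R) *
        ((Equiv.Perm.sign ρ : ℤ) : MvPolynomial ((Fin d × Fin d) × (Fin d × Fin d)) R) *
        ((Equiv.Perm.sign (σ' * π * ρ) : ℤ) : MvPolynomial ((Fin d × Fin d) × (Fin d × Fin d)) R) *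
        ((Equiv.Perm.sign (π * ρ) : ℤ) : MvPolynomial ((Fin d × Fin d) × (Fin d × Fin d)) R) =
      ((Equiv.Perm.sign σ : ℤ) : MvPolynomial ((Fin d × Fin d) × (Fin d × Fin d)) R) *
        ((Equiv.Perm.sign σ' : ℤ) : MvPolynomial ((Fin d × Fin d) × (Fin d × Fin d)) R) := by
    intro ρ σ σ' π
    have := congrArg (fun u : ℤˣ =>
      ((u : ℤ) : MvPolynomial ((Fin d × Fin d) × (Fin d × Fin d)) R)) (hu ρ σ σ' π)
    simpa only [Units.val_mul, Int.cast_mul] using this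
  -- monomials: reindex the product by `ρ`
  have hprod : ∀ ρ σ σ' π : Equiv.Perm (Fin d),
      (∏ i, (X ((((σ * ρ) i, ρ i), ((σ' * π * ρ) i, (π * ρ) i))) :
        MvPolynomial ((Fin d × Fin d) × (Fin d × Fin d)) R)) =
      ∏ t, X (((σ t, t), (σ' (π t), π t))) := by
    intro ρ σ σ' π
    exact Fintype.prod_equiv ρ _ _ fun i => by simp only [Equiv.Perm.mul_apply]
  -- components of the inverse reindexing
  have e0 : ∀ p, (quadPermEquiv d).symm p 0 = p.2.1 * p.1 := fun p => rfl
  have e1 : ∀ p, (quadPermEquiv d).symm p 1 = p.1 := fun p => rfl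
  have e2 : ∀ p, (quadPermEquiv d).symm p 2 = p.2.2.1 * p.2.2.2 * p.1 := fun p => rfl
  have e3 : ∀ p, (quadPermEquiv d).symm p 3 = p.2.2.2 * p.1 := fun p => rfl
  -- the hyperdeterminant side
  rw [hyperdet, ← Equiv.sum_comp (quadPermEquiv d).symm]
  simp only [kronPairArray, Fintype.sum_prod_type, Fin.prod_univ_four, e0, e1, e2, e3, hsign, hprod]
  rw [Finset.sum_const, Finset.card_univ, Fintype.card_perm, Fintype.card_fin]
  -- the `det ⊠ det` side
  congr 1
  rw [detPoly_eq_sum_sign_mul_prod, kronProd_sum_left]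
  refine Finset.sum_congr rfl fun σ _ => ?_
  rw [kronProd_sum_right]
  refine Finset.sum_congr rfl fun σ' _ => ?_
  rw [kronProd_intCast_mul_left, kronProd_intCast_mul_right, kronProd_prod_X, kronWord,
    Finset.mul_sum, Finset.mul_sum]
  refine Finset.sum_congr rfl fun π _ => ?_
  ring

end DetKron

/-! ## Functoriality of `⊠` under renaming of variables, and `x^d ⊠ h`

[Ike26 §4.2, Proposition (pro:boxtimesequivariance)]: "If f ≤ h and f̃ ≤ h̃, then
f ⊠ f̃ ≤ h ⊠ h̃" — proved there by `T(f) ⊠ T'(h) = P(f ⊠ h)` with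
`P(x_{i,j}) := Σ_{i',j'} α_{i',i} α'_{j',j} x_{i',j'}` for linear endomorphisms `T, T'`. We record the
case of COORDINATE maps (renamings `x_i ↦ x_{f i}`, `x_j ↦ x_{g j}`, not necessarily injective):
`rename f p ⊠ rename g q = rename (f × g) (p ⊠ q)`; and the identity "`x^d ⊠ det_d = d! det_d`"
used in the source's second proof of `det_d ≤ det_d ⊠ det_d` (§4.2, after (eq:detdet)). -/

section Functoriality

variable {σ : Type v} {τ : Type w} {σ' τ' : Type*} {R : Type u} [CommSemiring R] {d : ℕ}

/-- The content of a relabelled word is the pushed-forward content. [folklore] -/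
theorem wordExp_comp_left (f : σ → σ') (I : Fin d → σ) :
    wordExp (f ∘ I) = Finsupp.mapDomain f (wordExp I) := by
  rw [wordExp, wordExp, Finsupp.mapDomain_finsetSum]
  simp only [Function.comp_apply, Finsupp.mapDomain_single]

/-- `⊠` of relabelled words is the relabelled `⊠`. [cite: Ikenmeyer2026Kronecker, §4.2] -/
theorem kronWord_comp_comp (f : σ → σ') (g : τ → τ') (I : Fin d → σ) (J : Fin d → τ) :
    kronWord (R := R) (f ∘ I) (g ∘ J) = rename (Prod.map f g) (kronWord I J) := by
  simp only [kronWord, map_sum, map_prod, rename_X, Function.comp_apply, Prod.map_apply]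

/-- `⊠` of pushed-forward monomials is the relabelled `⊠`. [cite: Ikenmeyer2026Kronecker, §4.2] -/
theorem kronMonomial_mapDomain (f : σ → σ') (g : τ → τ') (a : σ →₀ ℕ) (b : τ →₀ ℕ) :
    kronMonomial (R := R) (Finsupp.mapDomain f a) (Finsupp.mapDomain g b) =
      rename (Prod.map f g) (kronMonomial a b) := by
  classical
  by_cases h : b.degree = a.degree
  · obtain ⟨I, hI⟩ := exists_wordExp_eq a rfl
    obtain ⟨J, hJ⟩ := exists_wordExp_eq b h
    rw [← hI, ← hJ, ← wordExp_comp_left, ← wordExp_comp_left, kronMonomial_wordExp,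
      kronMonomial_wordExp, kronWord_comp_comp]
  · rw [kronMonomial_of_degree_ne h, kronMonomial_of_degree_ne, map_zero]
    rwa [Finsupp.degree_mapDomain, Finsupp.degree_mapDomain]

/-- **`⊠` commutes with renaming of variables** (the coordinate-map case of
[Ike26 §4.2 Prop. (pro:boxtimesequivariance)] `T(f) ⊠ T'(h) = P(f ⊠ h)`):
`rename f p ⊠ rename g q = rename (f × g) (p ⊠ q)`. [cite: Ikenmeyer2026Kronecker, §4.2] -/
theorem kronProd_rename_rename (f : σ → σ') (g : τ → τ') (p : MvPolynomial σ R)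
    (q : MvPolynomial τ R) :
    kronProd (rename f p) (rename g q) = rename (Prod.map f g) (kronProd p q) := by
  induction p using MvPolynomial.induction_on' with
  | monomial a r =>
    induction q using MvPolynomial.induction_on' with
    | monomial b s =>
      rw [rename_monomial, rename_monomial, kronProd_monomial_monomial,
        kronProd_monomial_monomial, kronMonomial_mapDomain, map_mul (rename (Prod.map f g)),
        rename_C]
    | add q₁ q₂ h₁ h₂ => rw [map_add, kronProd_add_right, kronProd_add_right, map_add, h₁, h₂]
  | add p₁ p₂ h₁ h₂ => rw [map_add, kronProd_add_left, kronProd_add_left, map_add, h₁, h₂]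

/-- **`x_a^d ⊠ (x_{J 1} ⋯ x_{J d}) = d! · x_{(a,J 1)} ⋯ x_{(a,J d)}`** — the monomial case of the
source's "`x^d ⊠ det_d = d! det_d`". [cite: Ikenmeyer2026Kronecker, §4.2] -/
theorem kronProd_X_pow_prod_X (a : σ) (J : Fin d → τ) :
    kronProd ((X a : MvPolynomial σ R) ^ d) (∏ t, X (J t)) =
      (Nat.factorial d) • ∏ t, (X (a, J t) : MvPolynomial (σ × τ) R) := by
  have hpow : (X a : MvPolynomial σ R) ^ d = ∏ _t : Fin d, X a := by
    rw [Finset.prod_const, Finset.card_univ, Fintype.card_fin]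
  have hπ : ∀ π : Equiv.Perm (Fin d),
      (∏ t, X (a, J (π t)) : MvPolynomial (σ × τ) R) = ∏ t, X (a, J t) :=
    fun π => Equiv.prod_comp π (fun t => (X (a, J t) : MvPolynomial (σ × τ) R))
  rw [hpow, kronProd_prod_X (fun _ : Fin d => a) J, kronWord]
  simp only [hπ, Finset.sum_const, Finset.card_univ, Fintype.card_perm, Fintype.card_fin]

end Functoriality

section DetKronTwo

variable (d : ℕ) (R : Type u) [CommRing R]

/-- **`x^d ⊠ det_d = d! · det_d`** ([Ike26 §4.2], the identity behind the characteristic-0 proof of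
`det_d ≤ det_d ⊠ det_d`), with `det_d` on the right in the variables `x_{(a,(i,j))}`:
`x_a^d ⊠ det_d = d! · rename (a, ·) det_d`. [cite: Ikenmeyer2026Kronecker, §4.2] -/
theorem kronProd_X_pow_detPoly {σ : Type v} (a : σ) :
    kronProd ((X a : MvPolynomial σ R) ^ d) (detPoly (Fin d) R) =
      (Nat.factorial d) • rename (Prod.mk a) (detPoly (Fin d) R) := by
  rw [detPoly_eq_sum_sign_mul_prod, kronProd_sum_right, map_sum, Finset.smul_sum]
  refine Finset.sum_congr rfl fun σ' _ => ?_
  rw [kronProd_intCast_mul_right, kronProd_X_pow_prod_X, map_mul, map_intCast, map_prod,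
    mul_smul_comm]
  simp only [rename_X]

end DetKronTwo

/-! ### `x^d` is the `⊠`-unit up to `d!` and degree-`d` projection

[Ike26 §4.2] records the special case "`x^d ⊠ det_d = d! det_d`" (used there for
`det_d ≤ det_d ⊠ det_d` in characteristic `0`). The general statement proved here — for ANY `h`,
`x_a^d ⊠ h = d! · (degree-d part of h)(x_{(a,·)})` — follows from the definition (defboxtimes)
alone: every one of the `d!` permutations pairs the `d` copies of `x_a` with the letters of a
degree-`d` monomial of `h` in the same way, and monomials of other degrees are not paired at all
(the junk value `0` of `kronMonomial`). -/

section XPowUnit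

variable {σ : Type v} {τ : Type w} {R : Type u} [CommSemiring R] {d : ℕ}

/-- `x_a^d ⊠ (s · x^b) = d! · s · x_{(a,·)}^b` when `deg b = d`, and `= 0` otherwise (definition
(defboxtimes) termwise; the degree filter is the junk value of `kronMonomial`).
[cite: Ikenmeyer2026Kronecker, §4.2] -/
theorem kronProd_X_pow_monomial (a : σ) (b : τ →₀ ℕ) (s : R) :
    kronProd ((X a : MvPolynomial σ R) ^ d) (monomial b s) =
      if b.degree = d then (Nat.factorial d) • rename (Prod.mk a) (monomial b s) else 0 := by
  classical
  split_ifs with hb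
  · obtain ⟨J, hJ⟩ := exists_wordExp_eq b hb
    have hmon : (monomial b s : MvPolynomial τ R) = C s * ∏ t, X (J t) := by
      rw [prod_X_word_eq_monomial, hJ, C_mul_monomial, mul_one]
    rw [hmon, kronProd_C_mul_right, kronProd_X_pow_prod_X, map_mul (rename _), rename_C,
      map_prod, mul_smul_comm]
    simp only [rename_X]
  · have hXpow : (X a : MvPolynomial σ R) ^ d = monomial (wordExp fun _ : Fin d => a) 1 := by
      rw [← prod_X_word_eq_monomial, Finset.prod_const, Finset.card_univ, Fintype.card_fin]
    have hne : b.degree ≠ (wordExp fun _ : Fin d => a).degree := by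
      rwa [degree_wordExp]
    rw [hXpow, kronProd_monomial_monomial, kronMonomial_of_degree_ne hne, mul_zero]

/-- **`x_a^d ⊠ h = d! · (h)_d (x_{(a,·)})`** for every `h`: the Kronecker product with a `d`-th
power of a variable is `d!` times the degree-`d` homogeneous component, with the variables
renamed `x_j ↦ x_{(a,j)}` — the general form of [Ike26 §4.2] "`x^d ⊠ det_d = d! det_d`".
[cite: Ikenmeyer2026Kronecker, §4.2] -/
theorem kronProd_X_pow (a : σ) (h : MvPolynomial τ R) :
    kronProd ((X a : MvPolynomial σ R) ^ d) h =
      (Nat.factorial d) • rename (Prod.mk a) (homogeneousComponent d h) := by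
  classical
  conv_lhs => rw [h.as_sum]
  rw [kronProd_sum_right, homogeneousComponent_apply, map_sum, Finset.smul_sum,
    Finset.sum_filter]
  refine Finset.sum_congr rfl fun b _ => ?_
  rw [kronProd_X_pow_monomial]

/-- For `h` homogeneous of degree `d`: `x_a^d ⊠ h = d! · h(x_{(a,·)})` ([Ike26 §4.2], stated
there for `h = det_d`). [cite: Ikenmeyer2026Kronecker, §4.2] -/
theorem kronProd_X_pow_of_isHomogeneous (a : σ) {h : MvPolynomial τ R}
    (hh : h.IsHomogeneous d) :
    kronProd ((X a : MvPolynomial σ R) ^ d) h = (Nat.factorial d) • rename (Prod.mk a) h := by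
  rw [kronProd_X_pow, homogeneousComponent_of_mem ((mem_homogeneousSubmodule d h).mpr hh), if_pos rfl]

/-- For `h` homogeneous of degree `e ≠ d`: `x_a^d ⊠ h = 0` (no pairing of unequal degrees).
[cite: Ikenmeyer2026Kronecker, §4.2] -/
theorem kronProd_X_pow_of_isHomogeneous_ne (a : σ) {h : MvPolynomial τ R} {e : ℕ}
    (hh : h.IsHomogeneous e) (hne : e ≠ d) :
    kronProd ((X a : MvPolynomial σ R) ^ d) h = 0 := by
  rw [kronProd_X_pow, homogeneousComponent_of_mem ((mem_homogeneousSubmodule e h).mpr hh),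
    if_neg hne.symm, map_zero, smul_zero]

/-- Symmetric form: `h ⊠ x_a^d = d! · (h)_d (x_{(·,a)})`, from `kronProd_comm`.
[cite: Ikenmeyer2026Kronecker, §4.2] -/
theorem kronProd_pow_X (a : σ) (h : MvPolynomial τ R) :
    kronProd h ((X a : MvPolynomial σ R) ^ d) =
      (Nat.factorial d) • rename (fun j => (j, a)) (homogeneousComponent d h) := by
  rw [kronProd_comm, kronProd_X_pow, map_nsmul, rename_rename]
  rfl

end XPowUnit

/-! ### `⊠` multiplies Cayley hyperdeterminants: `Det_ℓ ⊠ Det_ℓ' = d! · Det_{ℓ+ℓ'}`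

[Ike26] abstract / §4.2 Example 4.10 item 5: "Cayley's first hyperdeterminant: `det_d^{⊠m}`". The
structural fact behind it, for the tree's combinatorial hyperdeterminant `hyperdet` (format
`d^{×ℓ}`, sum over `ℓ`-tuples of permutations, every geometric term counted `d!` times): for the
GENERIC arrays `I ↦ x_I` of formats `d^{×ℓ}` and `d^{×ℓ'}` with `ℓ'` even,
`Det(x_I) ⊠ Det(x_J) = d! · Det(x_{(K|_{<ℓ}, K|_{≥ℓ})})`, the right-hand side being the generic
array of format `d^{×(ℓ+ℓ')}` in the pair variables. With `Det_2(x_{ij}) = d! · det_d`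
(`hyperdet_two_generic`) this gives `det_d^{⊠m} ∼ Det_{2m}` for every `m` (up to the explicit
powers of `d!` and renaming of variables); `hyperdet_kronPairArray` above is the case `m = 2`
in pair coordinates. For odd `ℓ'` the sign characters do not match (and `Det_{odd} = 0`). -/

section HyperdetKron

variable (ℓ ℓ' d : ℕ) (R : Type u) [CommRing R]

/-- `hyperdet` with its sign product written as one integer cast. [folklore] -/
theorem hyperdet_eq_sum_intCast {S : Type*} [CommRing S] {m kk : ℕ} (A : (Fin m → Fin kk) → S) :
    hyperdet A = ∑ σ : Fin m → Equiv.Perm (Fin kk),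
      ((∏ j, (Equiv.Perm.sign (σ j) : ℤ) : ℤ) : S) * ∏ i, A fun j => σ j i := by
  unfold hyperdet
  simp only [Int.cast_prod]

/-- Sign products are blind to a common right factor when the number of slots is even:
`∏_j sgn(σ_j π) = ∏_j sgn(σ_j)` for `σ : Fin ℓ' → 𝔖_d`, `ℓ'` even. [folklore] -/
theorem prod_sign_mul_const_of_even {ℓ' d : ℕ} (hℓ' : Even ℓ')
    (σ' : Fin ℓ' → Equiv.Perm (Fin d)) (π : Equiv.Perm (Fin d)) :
    (∏ j, (Equiv.Perm.sign (σ' j * π) : ℤ)) = ∏ j, (Equiv.Perm.sign (σ' j) : ℤ) := by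
  have hp : ((Equiv.Perm.sign π : ℤˣ) : ℤ) ^ ℓ' = 1 := by
    obtain ⟨t, rfl⟩ := hℓ'
    rw [← two_mul, pow_mul, ← Units.val_pow_eq_pow_val, ← Units.val_pow_eq_pow_val, Int.units_sq,
      one_pow, Units.val_one]
  simp only [Equiv.Perm.sign_mul, Units.val_mul]
  rw [Finset.prod_mul_distrib, Finset.prod_const, Finset.card_univ, Fintype.card_fin, hp, mul_one]

/-- **KERNEL — `Det_ℓ(x) ⊠ Det_ℓ'(x) = d! · Det_{ℓ+ℓ'}(x)` for generic arrays, `ℓ'` even**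
([Ike26] abstract: "the Kronecker product of tensors is the operation that converts the
determinant polynomial into Cayley's first hyperdeterminant"; §4.2 Example 4.10 item 5 "Cayley's
first hyperdeterminant: `det_d^{⊠m}`" — the general multiplicativity from which all `m` follow).
[cite: Ikenmeyer2026Kronecker, §4.2] -/
theorem kronProd_hyperdet_generic (hℓ' : Even ℓ') :
    kronProd (hyperdet fun I : Fin ℓ → Fin d => (X I : MvPolynomial (Fin ℓ → Fin d) R))
        (hyperdet fun J : Fin ℓ' → Fin d => (X J : MvPolynomial (Fin ℓ' → Fin d) R)) =
      (Nat.factorial d) • hyperdet fun K : Fin (ℓ + ℓ') → Fin d =>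
        (X ((fun j => K (Fin.castAdd ℓ' j)), (fun j => K (Fin.natAdd ℓ j))) :
          MvPolynomial ((Fin ℓ → Fin d) × (Fin ℓ' → Fin d)) R) := by
  classical
  rw [hyperdet_eq_sum_intCast, hyperdet_eq_sum_intCast, hyperdet_eq_sum_intCast,
    kronProd_sum_left, ← (Fin.appendEquiv ℓ ℓ').sum_comp, Fintype.sum_prod_type, Finset.smul_sum]
  refine Finset.sum_congr rfl fun σ _ => ?_
  rw [kronProd_sum_right]
  -- expand each `⊠` of signed word monomials
  have hL : ∀ σ' : Fin ℓ' → Equiv.Perm (Fin d),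
      kronProd ((((∏ j, (Equiv.Perm.sign (σ j) : ℤ)) : ℤ) : MvPolynomial (Fin ℓ → Fin d) R) *
          ∏ i, X (fun j => σ j i))
        ((((∏ j, (Equiv.Perm.sign (σ' j) : ℤ)) : ℤ) : MvPolynomial (Fin ℓ' → Fin d) R) *
          ∏ i, X (fun j => σ' j i)) =
      ∑ π : Equiv.Perm (Fin d),
        (((∏ j, (Equiv.Perm.sign (σ j) : ℤ)) : ℤ) :
            MvPolynomial ((Fin ℓ → Fin d) × (Fin ℓ' → Fin d)) R) *
          ((((∏ j, (Equiv.Perm.sign (σ' j) : ℤ)) : ℤ) :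
              MvPolynomial ((Fin ℓ → Fin d) × (Fin ℓ' → Fin d)) R) *
            ∏ i, X ((fun j => σ j i), (fun j => σ' j (π i)))) := by
    intro σ'
    rw [kronProd_intCast_mul_left, kronProd_intCast_mul_right, kronProd_prod_X, kronWord,
      Finset.mul_sum, Finset.mul_sum]
  simp_rw [hL]
  rw [Finset.sum_comm]
  -- for each `π` the inner sum is the same sum (substitute `σ'' = σ' π`)
  have hT : ∀ π : Equiv.Perm (Fin d),
      (∑ σ' : Fin ℓ' → Equiv.Perm (Fin d),
        (((∏ j, (Equiv.Perm.sign (σ j) : ℤ)) : ℤ) :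
            MvPolynomial ((Fin ℓ → Fin d) × (Fin ℓ' → Fin d)) R) *
          ((((∏ j, (Equiv.Perm.sign (σ' j) : ℤ)) : ℤ) :
              MvPolynomial ((Fin ℓ → Fin d) × (Fin ℓ' → Fin d)) R) *
            ∏ i, X ((fun j => σ j i), (fun j => σ' j (π i))))) =
      ∑ σ'' : Fin ℓ' → Equiv.Perm (Fin d),
        (((∏ j, (Equiv.Perm.sign (σ j) : ℤ)) : ℤ) :
            MvPolynomial ((Fin ℓ → Fin d) × (Fin ℓ' → Fin d)) R) *
          ((((∏ j, (Equiv.Perm.sign (σ'' j) : ℤ)) : ℤ) :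
              MvPolynomial ((Fin ℓ → Fin d) × (Fin ℓ' → Fin d)) R) *
            ∏ i, X ((fun j => σ j i), (fun j => σ'' j i))) := by
    intro π
    refine Fintype.sum_equiv (Equiv.mulRight (fun _ : Fin ℓ' => π)) _ _ fun σ' => ?_
    simp only [Equiv.coe_mulRight, Pi.mul_apply, Equiv.Perm.coe_mul, Function.comp_apply]
    rw [prod_sign_mul_const_of_even hℓ' σ' π]
  simp_rw [hT]
  rw [Finset.sum_const, Finset.card_univ, Fintype.card_perm, Fintype.card_fin]
  refine congrArg (fun q => (Nat.factorial d) • q) (Finset.sum_congr rfl fun σ'' _ => ?_)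
  have happ : (Fin.appendEquiv ℓ ℓ') (σ, σ'') = Fin.append σ σ'' := rfl
  have hsg : (∏ j, (Equiv.Perm.sign (Fin.append σ σ'' j) : ℤ)) =
      (∏ j, (Equiv.Perm.sign (σ j) : ℤ)) * ∏ j, (Equiv.Perm.sign (σ'' j) : ℤ) := by
    rw [Fin.prod_univ_add]
    simp only [Fin.append_left, Fin.append_right]
  rw [happ, hsg, Int.cast_mul, mul_assoc]
  simp only [Fin.append_left, Fin.append_right]

/-- Change of summation variables `(σ₀, σ₁) ↔ (ρ, σ) := (σ₁, σ₀ σ₁⁻¹)` for two-slot sums.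
[folklore] -/
def pairPermEquiv : Equiv.Perm (Fin d) × Equiv.Perm (Fin d) ≃ (Fin 2 → Equiv.Perm (Fin d)) where
  toFun p := ![p.2 * p.1, p.1]
  invFun σ := (σ 1, σ 0 * (σ 1)⁻¹)
  left_inv p := by
    rcases p with ⟨ρ, σ₀⟩
    simp [mul_assoc]
  right_inv σ := by
    funext j
    fin_cases j <;> simp [mul_assoc]

/-- **`Det_2(x_{ij}) = d! · det_d`**: the two-slot combinatorial hyperdeterminant of the generic
matrix is `d!` times the determinant (in the variables `x_I`, `I : Fin 2 → Fin d`, i.e.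
`det_d` renamed along `(i, j) ↦ ![i, j]`). [folklore] -/
theorem hyperdet_two_generic :
    hyperdet (fun I : Fin 2 → Fin d => (X I : MvPolynomial (Fin 2 → Fin d) R)) =
      (Nat.factorial d) • rename (fun p : Fin d × Fin d => ![p.1, p.2]) (detPoly (Fin d) R) := by
  classical
  have hterm : ∀ ρ σ₀ : Equiv.Perm (Fin d),
      ((((∏ j, (Equiv.Perm.sign ((pairPermEquiv d) (ρ, σ₀) j) : ℤ)) : ℤ) :
          MvPolynomial (Fin 2 → Fin d) R) * ∏ i, X (fun j => (pairPermEquiv d) (ρ, σ₀) j i)) =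
        rename (fun p : Fin d × Fin d => ![p.1, p.2])
          (((Equiv.Perm.sign σ₀ : ℤ) : MvPolynomial (Fin d × Fin d) R) * ∏ i, X (σ₀ i, i)) := by
    intro ρ σ₀
    have hs : (∏ j, (Equiv.Perm.sign ((pairPermEquiv d) (ρ, σ₀) j) : ℤ)) =
        (Equiv.Perm.sign σ₀ : ℤ) := by
      rcases Int.units_eq_one_or (Equiv.Perm.sign ρ) with h | h <;>
        simp [pairPermEquiv, Fin.prod_univ_two, h]
    have hp : (∏ i, X (fun j => (pairPermEquiv d) (ρ, σ₀) j i) :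
          MvPolynomial (Fin 2 → Fin d) R) = ∏ t, X ![σ₀ t, t] := by
      refine Fintype.prod_equiv ρ _ _ fun i => ?_
      congr 1
      funext j
      fin_cases j <;> simp [pairPermEquiv, Equiv.Perm.mul_apply]
    rw [hs, hp, map_mul, map_intCast, map_prod]
    simp only [rename_X]
  rw [hyperdet_eq_sum_intCast, detPoly_eq_sum_sign_mul_prod, map_sum, Finset.smul_sum,
    ← (pairPermEquiv d).sum_comp, Fintype.sum_prod_type, Finset.sum_comm]
  refine Finset.sum_congr rfl fun σ₀ _ => ?_
  simp only [hterm, Finset.sum_const, Finset.card_univ, Fintype.card_perm, Fintype.card_fin]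

end HyperdetKron

/-! ### `⊠` is compatible with linear substitutions ([Ike26] 4.8 Proposition, printed p. 11)

[Ike26] §4.II, 4.8 Proposition (printed numbering, p. 11; the held text extraction's
sequential counter calls it "Proposition 2"): "If `f ≤ h` and `f̃ ≤ h̃`, then `f ⊠ f̃ ≤ h ⊠ h̃`." Its proof
(loc. cit.): for substitutions `T(x_i) = Σ_{i'} α_{i',i} x_{i'}`, `T'(x_j) = Σ_{j'} α'_{j',j} x_{j'}`
put `P(x_{i,j}) := Σ_{i',j'} α_{i',i} α'_{j',j} x_{i',j'}`; then `T(f) ⊠ T'(h) = P(f ⊠ h)`.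
In the tree's vocabulary (`linSubst σ k A : X i ↦ Σ_j A j i • X j`, `LinSubst.lean`) the matrix
of `P` is the Kronecker product `A ⊗ₖ B`, and the KERNEL identity is `kronProd_linSubst`; the
corollary for the endomorphism orbits `endOrbit` (the tree's model of the restriction preorder
on a FIXED set of variables — see the DIVERGENCE note in the pub-gct census: the source's `≤`
also allows changing the number of variables) is `kronProd_mem_endOrbit`. -/

section LinSubstKron

open scoped Kronecker

variable {σ : Type v} {τ : Type w} {R : Type u} {d : ℕ}

/-- Forms of different degrees have Kronecker product `0` (the junk-value convention of
`kronProd`, cf. its docstring). [cite: Ikenmeyer2026Kronecker, §4.2] -/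
theorem kronProd_of_isHomogeneous_ne [CommSemiring R] {f : MvPolynomial σ R}
    {h : MvPolynomial τ R} {m e : ℕ} (hf : f.IsHomogeneous m) (hh : h.IsHomogeneous e)
    (hne : m ≠ e) : kronProd f h = 0 := by
  classical
  rw [f.as_sum, kronProd_sum_left]
  refine Finset.sum_eq_zero fun a ha => ?_
  rw [h.as_sum, kronProd_sum_right]
  refine Finset.sum_eq_zero fun b hb => ?_
  have ha' : a.degree = m := by
    by_contra hc
    exact (mem_support_iff.mp ha) (hf.coeff_eq_zero hc)
  have hb' : b.degree = e := by
    by_contra hc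
    exact (mem_support_iff.mp hb) (hh.coeff_eq_zero hc)
  have hba : b.degree ≠ a.degree := by
    rw [ha', hb']
    exact fun h' => hne h'.symm
  rw [kronProd_monomial_monomial, kronMonomial_of_degree_ne hba, mul_zero]

/-- `monomial a c = C c · monomial a 1`. [folklore] -/
theorem monomial_eq_C_mul_monomial_one {υ : Type*} {S : Type*} [CommSemiring S] (a : υ →₀ ℕ)
    (c : S) : (monomial a c : MvPolynomial υ S) = C c * monomial a 1 := by
  rw [C_mul_monomial, mul_one]

variable [Fintype σ] [Fintype τ] {k : Type u} [CommRing k]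

/-- A linear substitution on a word monomial: `T(∏_t x_{I t}) = Σ_{I'} (∏_t A_{I' t, I t}) ∏_t x_{I' t}`.
[folklore] -/
theorem linSubst_prod_X (A : Matrix σ σ k) (I : Fin d → σ) :
    linSubst σ k A (∏ t, X (I t)) = ∑ I' : Fin d → σ, C (∏ t, A (I' t) (I t)) * ∏ t, X (I' t) := by
  classical
  rw [map_prod]
  simp_rw [linSubst_X, smul_eq_C_mul]
  rw [Fintype.prod_sum]
  refine Finset.sum_congr rfl fun I' _ => ?_
  rw [Finset.prod_mul_distrib, map_prod]

/-- Pairing a word in `σ` with a `π`-shuffled word in `τ`: `(I', J') ↦ (t ↦ (I' t, J' (π t)))`.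
[folklore] -/
def pairWordEquiv (π : Equiv.Perm (Fin d)) : (Fin d → σ) × (Fin d → τ) ≃ (Fin d → σ × τ) where
  toFun p := fun t => (p.1 t, p.2 (π t))
  invFun K := (fun t => (K t).1, fun t => (K (π.symm t)).2)
  left_inv p := by
    rcases p with ⟨I', J'⟩
    simp
  right_inv K := by
    funext t
    simp

/-- [Ike26] §4.II, proof of 4.8 Proposition, step `(∗)` on word monomials:
`T(∏ x_{I t}) ⊠ T'(∏ x_{J t}) = P((∏ x_{I t}) ⊠ (∏ x_{J t}))` with `P = A ⊗ₖ B`.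
[cite: Ikenmeyer2026Kronecker, §4.2] -/
theorem kronProd_linSubst_prod_X (A : Matrix σ σ k) (B : Matrix τ τ k) (I : Fin d → σ)
    (J : Fin d → τ) :
    kronProd (linSubst σ k A (∏ t, X (I t))) (linSubst τ k B (∏ t, X (J t))) =
      linSubst (σ × τ) k (A ⊗ₖ B) (kronWord I J) := by
  classical
  rw [linSubst_prod_X, linSubst_prod_X, kronProd_sum_left]
  simp_rw [kronProd_sum_right, kronProd_C_mul_left, kronProd_C_mul_right, kronProd_prod_X]
  conv_rhs => rw [kronWord, map_sum]
  simp_rw [linSubst_prod_X, kronWord, Finset.mul_sum]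
  -- LHS : Σ_{I'} Σ_{J'} Σ_π C α · (C β · ∏ x_{(I' t, J' (π t))});  RHS : Σ_π Σ_{K'} C γ · ∏ x_{K' t}
  have hpair : (∑ I' : Fin d → σ, ∑ J' : Fin d → τ, ∑ π : Equiv.Perm (Fin d),
      C (∏ t, A (I' t) (I t)) * (C (∏ t, B (J' t) (J t)) *
        ∏ t, (X (I' t, J' (π t)) : MvPolynomial (σ × τ) k))) =
      ∑ p : (Fin d → σ) × (Fin d → τ), ∑ π : Equiv.Perm (Fin d),
        C (∏ t, A (p.1 t) (I t)) * (C (∏ t, B (p.2 t) (J t)) *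
          ∏ t, (X (p.1 t, p.2 (π t)) : MvPolynomial (σ × τ) k)) := by
    rw [Fintype.sum_prod_type]
  rw [hpair, Finset.sum_comm]
  refine Finset.sum_congr rfl fun π _ => ?_
  refine Fintype.sum_equiv (pairWordEquiv π) _ _ fun p => ?_
  have hβ : (∏ t, B (p.2 (π t)) (J (π t))) = ∏ t, B (p.2 t) (J t) :=
    Fintype.prod_equiv π _ _ fun t => rfl
  simp only [pairWordEquiv, Equiv.coe_fn_mk, Matrix.kronecker_apply]
  rw [Finset.prod_mul_distrib, hβ, map_mul, mul_assoc]

/-- **KERNEL — `⊠` intertwines linear substitutions** ([Ike26] §4.II, proof of 4.8 Proposition (p. 11):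
"`T(f) ⊠ T'(h) = P(f ⊠ h)`" with `P(x_{i,j}) = Σ_{i',j'} α_{i',i} α'_{j',j} x_{i',j'}`): for square
matrices `A`, `B`, `(A·f) ⊠ (B·h) = (A ⊗ₖ B)·(f ⊠ h)`, for ALL polynomials `f`, `h`.
[cite: Ikenmeyer2026Kronecker, §4.2] -/
theorem kronProd_linSubst (A : Matrix σ σ k) (B : Matrix τ τ k) (f : MvPolynomial σ k)
    (h : MvPolynomial τ k) :
    kronProd (linSubst σ k A f) (linSubst τ k B h) =
      linSubst (σ × τ) k (A ⊗ₖ B) (kronProd f h) := by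
  classical
  -- monic monomials
  have hmon : ∀ (a : σ →₀ ℕ) (b : τ →₀ ℕ),
      kronProd (linSubst σ k A (monomial a 1)) (linSubst τ k B (monomial b 1)) =
        linSubst (σ × τ) k (A ⊗ₖ B) (kronMonomial a b) := by
    intro a b
    by_cases hdeg : b.degree = a.degree
    · obtain ⟨I, hI⟩ := exists_wordExp_eq a rfl
      obtain ⟨J, hJ⟩ := exists_wordExp_eq b hdeg
      rw [← hI, ← hJ, ← prod_X_word_eq_monomial, ← prod_X_word_eq_monomial, kronMonomial_wordExp,
        kronProd_linSubst_prod_X]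
    · rw [kronMonomial_of_degree_ne hdeg, map_zero]
      exact kronProd_of_isHomogeneous_ne (linSubst_isHomogeneous A (isHomogeneous_monomial _ rfl))
        (linSubst_isHomogeneous B (isHomogeneous_monomial _ rfl)) fun h' => hdeg h'.symm
  -- bilinear extension
  rw [f.as_sum, h.as_sum, map_sum (linSubst σ k A), map_sum (linSubst τ k B), kronProd_sum_left,
    kronProd_sum_left, map_sum (linSubst (σ × τ) k (A ⊗ₖ B))]
  refine Finset.sum_congr rfl fun a _ => ?_
  rw [kronProd_sum_right, kronProd_sum_right, map_sum (linSubst (σ × τ) k (A ⊗ₖ B))]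
  refine Finset.sum_congr rfl fun b _ => ?_
  rw [kronProd_monomial_monomial, map_mul (linSubst (σ × τ) k (A ⊗ₖ B)), linSubst_C, ← hmon,
    monomial_eq_C_mul_monomial_one a (coeff a f), monomial_eq_C_mul_monomial_one b (coeff b h),
    map_mul (linSubst σ k A), linSubst_C, map_mul (linSubst τ k B), linSubst_C,
    kronProd_C_mul_left, kronProd_C_mul_right, ← mul_assoc, ← map_mul]

/-- **[Ike26] 4.8 Proposition** (§4.II, p. 11; "If `f ≤ h` and `f̃ ≤ h̃`, then `f ⊠ f̃ ≤ h ⊠ h̃`"), in the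
tree's model of `≤` by endomorphism orbits on fixed variable sets: `⊠` maps
`End·g × End·g'` into `End·(g ⊠ g')`. [cite: Ikenmeyer2026Kronecker, §4.2] -/
theorem kronProd_mem_endOrbit {f g : MvPolynomial σ k} {f' g' : MvPolynomial τ k}
    (hf : f ∈ endOrbit σ k g) (hf' : f' ∈ endOrbit τ k g') :
    kronProd f f' ∈ endOrbit (σ × τ) k (kronProd g g') := by
  obtain ⟨A, rfl⟩ := hf
  obtain ⟨B, rfl⟩ := hf'
  exact ⟨A ⊗ₖ B, (kronProd_linSubst A B g g').symm⟩

end LinSubstKron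

/-! ### `f ⊠ h ∈ S_d` and associativity of `⊠` ([Ike26] §4.II, eq. (4.6))

[Ike26] §4.II (printed p. 11): "Let `R` be a commutative semiring, and let `A = 𝒮`. For `f, h ∈ A_d` we
define `f ⊠ h ∈ A_d` via [(4.4)]" — with `A = 𝒮` the polynomial semiring this is the statement
abbreviated `f ⊠ h ∈ S_d` in this section's title and lemma names (a specialisation of the
printed sentence, not a verbatim string) — and "This readily shows the associativity of the
Kronecker product:
`((x_{i_1}⋯x_{i_d}) ⊠ (x_{j_1}⋯x_{j_d})) ⊠ (x_{k_1}⋯x_{k_d}) = Σ_{σ,π ∈ 𝔖_d} x_{i_{σ(1)},j_1,k_{π(1)}} ⋯ x_{i_{σ(d)},j_d,k_{π(d)}} = (x_{i_1}⋯x_{i_d}) ⊠ ((x_{j_1}⋯x_{j_d}) ⊠ (x_{k_1}⋯x_{k_d}))`"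
(eq. (4.6), TeX label `eq:kronprodassoc`, printed p. 11). In the tree the two sides live in the variables `(σ × τ) × υ` and `σ × (τ × υ)`;
the KERNEL statement `kronProd_assoc` identifies them along `Equiv.prodAssoc`, for ALL
polynomials (trilinear extension, degree bookkeeping by the junk-value convention). -/

section KronAssoc

variable {σ : Type v} {τ : Type w} {υ : Type*} {R : Type u} [CommSemiring R] {d : ℕ}

/-- `(∏ x_{I t}) ⊠ (∏ x_{J t})` is a form of degree `d` ([Ike26] §4.II, p. 11: "For `f, h ∈ A_d` we
define `f ⊠ h ∈ A_d`", `A = 𝒮`).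
[cite: Ikenmeyer2026Kronecker, §4.2] -/
theorem kronWord_isHomogeneous (I : Fin d → σ) (J : Fin d → τ) :
    (kronWord I J : MvPolynomial (σ × τ) R).IsHomogeneous d := by
  classical
  unfold kronWord
  refine IsHomogeneous.sum _ _ _ fun π _ => ?_
  have h := IsHomogeneous.prod Finset.univ (fun t : Fin d => (X (I t, J (π t)) :
    MvPolynomial (σ × τ) R)) (fun _ => 1) fun t _ => isHomogeneous_X R _
  simpa using h

/-- `x^a ⊠ x^b` is a form of degree `|a|`. [cite: Ikenmeyer2026Kronecker, §4.2] -/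
theorem kronMonomial_isHomogeneous (a : σ →₀ ℕ) (b : τ →₀ ℕ) :
    (kronMonomial a b : MvPolynomial (σ × τ) R).IsHomogeneous a.degree := by
  classical
  by_cases hab : b.degree = a.degree
  · obtain ⟨I, hI⟩ := exists_wordExp_eq a rfl
    obtain ⟨J, hJ⟩ := exists_wordExp_eq b hab
    rw [← hI, ← hJ, kronMonomial_wordExp, degree_wordExp]
    exact kronWord_isHomogeneous I J
  · rw [kronMonomial_of_degree_ne hab]
    exact isHomogeneous_zero _ _ _

/-- **`f ⊠ h ∈ S_d`** ([Ike26] §4.II, p. 11: "For `f, h ∈ A_d` we define `f ⊠ h ∈ A_d`", with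
`A = 𝒮`): if `f` is a form of degree `d` then so is `f ⊠ h` (for
every `h`; symmetric statement `kronProd_isHomogeneous_right`).
[cite: Ikenmeyer2026Kronecker, §4.2] -/
theorem kronProd_isHomogeneous_left {f : MvPolynomial σ R} (hf : f.IsHomogeneous d)
    (h : MvPolynomial τ R) : (kronProd f h).IsHomogeneous d := by
  classical
  rw [f.as_sum, kronProd_sum_left]
  refine IsHomogeneous.sum _ _ _ fun a ha => ?_
  rw [h.as_sum, kronProd_sum_right]
  refine IsHomogeneous.sum _ _ _ fun b _ => ?_
  have ha' : a.degree = d := by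
    by_contra hc
    exact (mem_support_iff.mp ha) (hf.coeff_eq_zero hc)
  rw [kronProd_monomial_monomial, ← ha']
  simpa using (isHomogeneous_C (σ × τ) (coeff a f * coeff b h)).mul
    (kronMonomial_isHomogeneous (R := R) a b)

/-- `f ⊠ h ∈ S_d` when `h ∈ S_d` ([Ike26] §4.II, p. 11, "`f ⊠ h ∈ A_d`" with `A = 𝒮`; here for
every `f`). [cite: Ikenmeyer2026Kronecker, §4.2] -/
theorem kronProd_isHomogeneous_right (f : MvPolynomial σ R) {h : MvPolynomial τ R}
    (hh : h.IsHomogeneous d) : (kronProd f h).IsHomogeneous d := by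
  rw [kronProd_comm]
  exact IsHomogeneous.rename_isHomogeneous (kronProd_isHomogeneous_left hh f)

/-- [Ike26] §4.II eq. (4.6) on word monomials, both sides transported to the variables
`(σ × τ) × υ`. [cite: Ikenmeyer2026Kronecker, §4.2] -/
theorem kronProd_assoc_prod_X (I : Fin d → σ) (J : Fin d → τ) (K : Fin d → υ) :
    kronProd (kronProd (∏ t, X (I t) : MvPolynomial σ R) (∏ t, X (J t))) (∏ t, X (K t)) =
      rename (Equiv.prodAssoc σ τ υ).symm
        (kronProd (∏ t, X (I t) : MvPolynomial σ R)
          (kronProd (∏ t, X (J t) : MvPolynomial τ R) (∏ t, X (K t)))) := by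
  classical
  rw [kronProd_prod_X, kronProd_prod_X, kronWord, kronWord, kronProd_sum_left, kronProd_sum_right,
    map_sum (rename _)]
  simp_rw [kronProd_prod_X, kronWord, map_sum, map_prod, rename_X, Equiv.prodAssoc_symm_apply]
  conv_rhs => rw [Finset.sum_comm]
  refine Finset.sum_congr rfl fun π _ => ?_
  exact (Fintype.sum_equiv (Equiv.mulRight π) _ _ fun ρ => rfl).symm

/-- [Ike26] §4.II eq. (4.6) for monic monomials (all degree patterns).
[cite: Ikenmeyer2026Kronecker, §4.2] -/
theorem kronProd_assoc_monomial (a : σ →₀ ℕ) (b : τ →₀ ℕ) (c : υ →₀ ℕ) :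
    kronProd (kronProd (monomial a (1 : R)) (monomial b 1)) (monomial c (1 : R)) =
      rename (Equiv.prodAssoc σ τ υ).symm
        (kronProd (monomial a (1 : R)) (kronProd (monomial b (1 : R)) (monomial c 1))) := by
  classical
  by_cases hab : b.degree = a.degree
  · by_cases hbc : c.degree = b.degree
    · obtain ⟨I, hI⟩ := exists_wordExp_eq a rfl
      obtain ⟨J, hJ⟩ := exists_wordExp_eq b hab
      obtain ⟨K, hK⟩ := exists_wordExp_eq c (hbc.trans hab)
      rw [← hI, ← hJ, ← hK, ← prod_X_word_eq_monomial, ← prod_X_word_eq_monomial,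
        ← prod_X_word_eq_monomial]
      exact kronProd_assoc_prod_X I J K
    · rw [kronProd_monomial_monomial b c, kronMonomial_of_degree_ne hbc, mul_zero,
        kronProd_zero_right, map_zero, kronProd_monomial_monomial, mul_one, C_1, one_mul]
      exact kronProd_of_isHomogeneous_ne (kronMonomial_isHomogeneous a b)
        (isHomogeneous_monomial _ rfl) fun h' => hbc (h'.symm.trans hab.symm)
  · rw [kronProd_monomial_monomial a b, kronMonomial_of_degree_ne hab, mul_zero,
      kronProd_zero_left, kronProd_monomial_monomial, mul_one, C_1, one_mul,
      kronProd_of_isHomogeneous_ne (isHomogeneous_monomial _ rfl) (kronMonomial_isHomogeneous b c)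
        (fun h' => hab h'.symm), map_zero]

/-- **KERNEL — associativity of `⊠`** ([Ike26] §4.II eq. (4.6)): `(f ⊠ g) ⊠ h` is
`f ⊠ (g ⊠ h)` with the variables `x_{(i,(j,k))}` renamed `x_{((i,j),k)}`, for all polynomials.
[cite: Ikenmeyer2026Kronecker, §4.2] -/
theorem kronProd_assoc (f : MvPolynomial σ R) (g : MvPolynomial τ R) (h : MvPolynomial υ R) :
    kronProd (kronProd f g) h =
      rename (Equiv.prodAssoc σ τ υ).symm (kronProd f (kronProd g h)) := by
  classical
  rw [f.as_sum, kronProd_sum_left, kronProd_sum_left, kronProd_sum_left, map_sum (rename _)]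
  refine Finset.sum_congr rfl fun a _ => ?_
  rw [g.as_sum, kronProd_sum_right, kronProd_sum_left, kronProd_sum_left, kronProd_sum_right,
    map_sum (rename _)]
  refine Finset.sum_congr rfl fun b _ => ?_
  rw [h.as_sum, kronProd_sum_right, kronProd_sum_right, kronProd_sum_right, map_sum (rename _)]
  refine Finset.sum_congr rfl fun c _ => ?_
  rw [monomial_eq_C_mul_monomial_one a (coeff a f), monomial_eq_C_mul_monomial_one b (coeff b g),
    monomial_eq_C_mul_monomial_one c (coeff c h)]
  simp only [kronProd_C_mul_left, kronProd_C_mul_right, map_mul, rename_C]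
  rw [kronProd_assoc_monomial]

end KronAssoc

end Literature.Computability.AlgebraicComplexity
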